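import Summits.AnomalousDissipation.AnomalousDissipation.Theorems.MirrorVarietyTaylorGreenLoudGalerkinStatesStubTgForceRegular
import Summits.AnomalousDissipation.AnomalousDissipation.Theorems.MirrorVarietyTaylorGreenLoudGalerkinStatesStubCriticality
import Summits.AnomalousDissipation.AnomalousDissipation.Theorems.MirrorVarietyTaylorGreenLoudGalerkinStatesStubGalerkinNewton
import Summits.AnomalousDissipation.AnomalousDissipation.Theorems.MirrorVarietyTaylorGreenLoudGalerkinStatesStubScaling
import Summits.AnomalousDissipation.AnomalousDissipation.Theorems.MirrorVarietyTaylorGreenLoudGalerkinStatesStubGaugeNorms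
import Summits.AnomalousDissipation.AnomalousDissipation.Theorems.MirrorVarietyTaylorGreenLoudGalerkinStatesStubGaugeBackward
import Summits.AnomalousDissipation.AnomalousDissipation.Theorems.MirrorVarietyTaylorGreenLoudGalerkinStatesStubAutomaticLoudness
import Summits.AnomalousDissipation.AnomalousDissipation.Theorems.MirrorVarietyTaylorGreenLoudGalerkinStatesStubGaugeForward
import Summits.AnomalousDissipation.AnomalousDissipation.Theorems.MirrorVarietyTaylorGreenLoudGalerkinStatesGauge

/-!
# Line `stagnation-plug-froth` — LEAD'S skeleton v4 (gauge reshape of the heart) for the crux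
# `MirrorVariety.TaylorGreenLoudGalerkinStates` (stmt-AnomalousDissipation-2987; lead prover-line-stmt-AnomalousDissipation-2987-0, 2026-08-16)

Crux (fixed, by name): for the Taylor–Green force `f_TG` there are `ν_j → 0⁺`, `E`, `ε > 0` with, for every `j` and ALL large
resolutions `N`, a loud bounded Fourier–Galerkin steady state (`∫|U|² ≤ E`, `ν_j‖∇U‖² ≥ ε`, tested Galerkin equations against
every band-limited smooth div-free `a`).

STATE OF THE LINE (v4).  Everything except the heart was ALREADY in the tree, sorry-free, as `--supports` files of the item:
vocabulary + composition `TaylorGreenLoudGalerkinStates_of` (`Theorems/MirrorVarietyTaylorGreenLoudGalerkinStatesLine.lean`, p73960),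
`stub_tgForceRegular` (p75219), `stub_criticality` (p77832), `stub_galerkinNewton` (glue of `stub_truncation` p85290,
`stub_discreteInfSup` p84898, `stub_discreteKantorovich` p87441).  v3 (previous lead) closed the crux modulo `stub_froth` alone.

v4 = THIS LEAD'S RESHAPE OF THE HEART through the frozen-cell AMPLITUDE GAUGE (idea card
`Cruxes/…/Ideas/frozen-cell-amplitude-gauge.md`, sketch `Cruxes/…/SketchIdeator2g2.lean`): write a `K`-symmetric steady state as
`2•f_TG + v` with `v ⊥ f_TG` (`‖2f_TG‖_{L²} = 1`, `Δ f_TG = −12π² f_TG`), let the viscosity float and recover the force amplitude from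
the energy identity; by the exact covariance `(U, ν, f) ↦ (U/s, ν/s, f/s²)` of the tested steady form, `stub_froth` (Newton data
with `η_j = 0`) follows — `stub_froth_of_gauge`, sorry-free below — from the six registered stubs of §1–§2:
* `stub_gaugeHeart` (OPEN, the heart; lead): along gauge viscosities `ν_j → 0⁺`, exact `K`-symmetric frozen-cell solutions `v_j`
  (`v_j ⊥ f_TG`, tested equations of `2f_TG + v_j` against every `K`-field `b ⊥ f_TG`) with ONE `L²` bound `∫|v_j|² ≤ C`, ONE
  non-degeneration `ν_j‖∇v_j‖² ≥ c > 0`, and a `K`-inf-sup constant `M_j` of the linearisation at `2f_TG + v_j`;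
* `stub_automaticLoudness` (worker): `ν‖∇v‖² ≤ 100(√C + C)` for every frozen-cell solution with `∫|v|² ≤ C` — loudness is automatic;
* `stub_gaugeForward` (worker): frozen-cell equations ⊥ force ⇒ the full `K`-tested equations with force `2ν(12π² + ‖∇v‖²)•f_TG`;
* `stub_gaugeNorms` (worker): `2f_TG + v` is a `K`-field, `∫|2f_TG+v|² = 1 + ∫|v|²`, `‖∇(2f_TG+v)‖² = 12π² + ‖∇v‖²`;
* `stub_scaling` (worker): covariance of `testedForm`, `linForm`, energy and enstrophy under `(U,ν,g) ↦ (U/s, ν/s, g/s²)`;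
* `stub_gaugeBackward` (worker; the converse, honesty direction — every `K`-symmetric steady TG state is a rescaled frozen-cell
  solution — so the new heart is an EQUIVALENT of `stub_froth`'s exact content, not a weakening; not used in the composition).
Composition: `TaylorGreenLoudGalerkinStates_of_stubs` concludes the route decl BY NAME.  WAVE 1 (2026-08-16): all five dictionary
stubs LANDED (`stub_scaling` p96213, `stub_gaugeNorms` p96359, `stub_gaugeBackward` p96493, `stub_automaticLoudness` p96616,
`stub_gaugeForward` p96779) and the lead's glue landed as `Theorems/MirrorVarietyTaylorGreenLoudGalerkinStatesGauge.lean` (p96252: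
`stub_froth_of_gauge`, `TaylorGreenLoudGalerkinStates_of_gauge`, registered sub-goal `gauge_glue`).  THE ONLY `sorry` LEFT IS THE HEART
`stub_gaugeHeart` (the steady zeroth law for `f_TG` in the amplitude gauge, `K`-class).

Disproof honoured (tree `Cruxes/TaylorGreenLoudGalerkinStates/Disproof.lean`, gen 3, NO KILL, re-read 2026-08-16T10:20Z):
`taylorGreenLoud_false_without_force` — the gauge does not exist for `f = 0` and `f_TG` is frozen into `stub_gaugeHeart`'s equations;
`not_loud_of_energy_lt_four_sq` / `resolution_floor` / `not_loud_uniformly_in_resolution` — `Ẽ − 4W̃² = ‖v‖²/(2a′) ≥ 0` is an identity of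
the dictionary and `N₀(j)` stays `j`-dependent inside the landed `stub_galerkinNewton`; §4 audit of the v2 stubs stands (untouched);
§5.3 numerics (laminar `K`-branch = frustrated runaway) say the heart's witnesses are off the laminar branch (triage r1-2 F1: the
Newton-data relaxation is only an `O(ν²)` tolerance, so the heart is stated with exact solutions).
-/

set_option linter.dupNamespace false

noncomputable section

open scoped BigOperators Topology InnerProductSpace
open Filter MeasureTheory
open Literature.Analysis.FunctionSpaces Literature.Analysis.FunctionSpaces.Torus

namespace Summit.AnomalousDissipation.AnomalousDissipation.Cruxes.TaylorGreenLoudGalerkinStates.StagnationPlugFroth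

open Summit.AnomalousDissipation.AnomalousDissipation.Theorems.TaylorGreenLoudGalerkinStates
open Summit.AnomalousDissipation.AnomalousDissipation.Theorems.TaylorGreenLoudGalerkinStates.Negative

/-! ## §0 Sanity: the imported vocabulary is the crux's (definitional) -/

example :
    Summit.AnomalousDissipation.AnomalousDissipation.Theses.MirrorVariety.TaylorGreenLoudGalerkinStates ↔
      LoudBoundedStates tgForce :=
  crux_iff

/-! ## §1 The heart (open): bounded, non-work-free, nondegenerate frozen-cell solutions in the `K`-class -/

/-- **stub_gaugeHeart** (LOAD-BEARING; open-problem-hard; the crux's PDE content in the amplitude gauge).  Along some gauge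
viscosities `ν_j → 0⁺` there are `K`-fields `v_j` (smooth, div-free, mean-zero, `K`-symmetric), orthogonal to the force, such that
`2•f_TG + v_j` solves the tested steady equations at viscosity `ν_j` against every `K`-field test ORTHOGONAL TO THE FORCE (the
frozen-cell problem: steady Navier–Stokes for the secondary flow of the unit Taylor–Green cell; no force amplitude occurs), with
(i) ONE a-priori bound `∫|v_j|² ≤ C`, (ii) ONE non-degeneration `ν_j‖∇v_j‖² ≥ c > 0` (the secondary flow keeps dissipating), and
(iii) a `K`-inf-sup constant `M_j` for the linearisation `linForm (ν j) (2•f_TG + v_j)` on `K`-fields (nondegeneracy in the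
`K`-class, needed by the landed Brezzi–Rappaz–Raviart transfer).  Loudness and the energy window of the rescaled physical states
are then automatic (`stub_automaticLoudness`, `stub_froth_of_gauge`).  Equivalent to `stub_froth` with `η_j = 0`
(`stub_gaugeBackward` is the converse direction). -/
theorem stub_gaugeHeart :
    ∃ (ν : ℕ → ℝ) (v : ℕ → UnitAddTorus (Fin 3) → EuclideanSpace ℝ (Fin 3)) (C c : ℝ) (M : ℕ → ℝ),
      (∀ j, 0 < ν j) ∧ Filter.Tendsto ν Filter.atTop (nhds 0) ∧ 0 < c ∧
      ∀ j, IsKField (v j) ∧ (∫ x, inner ℝ (tgForce x) (v j x)) = 0 ∧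
        (∀ b, IsKField b → (∫ x, inner ℝ (tgForce x) (b x)) = 0 →
          testedForm (ν j) tgForce ((2 : ℝ) • tgForce + v j) b = 0) ∧
        ∫ x, ‖v j x‖ ^ 2 ≤ C ∧ c ≤ ν j * gradNormSq (v j) ∧
        (∀ w, IsKField w → ∃ a, IsKField a ∧
            Real.sqrt (gradNormSq w) * Real.sqrt (gradNormSq a) ≤ M j * linForm (ν j) ((2 : ℝ) • tgForce + v j) w a ∧
            (0 < gradNormSq w → 0 < gradNormSq a)) := by
  sorry

/-! ## §2 The dictionary (registered worker stubs; all true, S–M sized) -/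

/-- **stub_automaticLoudness** (loudness is automatic in the gauge).  For a frozen-cell solution `v` at gauge viscosity `ν > 0`
with `∫|v|² ≤ C`: `ν‖∇v‖² ≤ 100(√C + C)`.  Proof map: test the frozen-cell equations with `b := v` to get
`ν‖∇v‖² = ∫⟪2f+v, ((2f+v)·∇)v⟫ = −∫⟪v,((2f)·∇)(2f)⟫ − ∫⟪v,(v·∇)(2f)⟫` (antisymmetry `integral_inner_convect_eq_neg`, Green
`integral_inner_laplacian_eq_neg_holds`, `integral_inner_laplacian_tgForce`), then Cauchy–Schwarz with the pointwise bounds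
`‖f_TG‖ ≤ 1` (`norm_tgForce_le`) and `‖∇f_TG‖ ≤ 12π`-type bounds from `tgForce_eq_realTrigPoly` (`TorusTrigPolyDerivBounds`);
the sharp constants are `π√C + 4πC`. [folklore] -/
theorem stub_automaticLoudness :
    ∀ (ν C : ℝ) (v : UnitAddTorus (Fin 3) → EuclideanSpace ℝ (Fin 3)), 0 < ν → 0 ≤ C → IsKField v →
      (∫ x, inner ℝ (tgForce x) (v x)) = 0 →
      (∀ b, IsKField b → (∫ x, inner ℝ (tgForce x) (b x)) = 0 →
        testedForm ν tgForce ((2 : ℝ) • tgForce + v) b = 0) →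
      ∫ x, ‖v x‖ ^ 2 ≤ C → ν * gradNormSq v ≤ 100 * (Real.sqrt C + C) :=
  AutomaticLoudness.stub_automaticLoudness  -- LANDED (p96616)

/-- **stub_gaugeForward** (the gauge, forward direction).  If the `K`-field `v ⊥ f_TG` solves the frozen-cell equations at
viscosity `ν` (tested equations of `2f_TG + v` against every `K`-field `b ⊥ f_TG`), then `2f_TG + v` solves the FULL `K`-tested
steady equations at viscosity `ν` with the force `2ν(12π² + ‖∇v‖²) • f_TG`.  Proof map: split a `K`-field test `a = t•(2f) + b`,
`t = 2∫⟪f,a⟫`, `b ⊥ f` a `K`-field; `testedForm` is affine in the test (`testedForm_add/smul`-type algebra,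
`SteadyNSTestedFormAlgebra`); the `b`-part is the hypothesis (the force term `⟪g, b⟫` vanishes for any multiple `g` of `f`); the
`f`-part: `∫⟪U,(U·∇)U⟫ = 0` (antisymmetry) and the equation tested with `b := v` give `∫⟪U,(U·∇)(2f)⟫ = −ν‖∇v‖²`, while
`∫⟪U, Δ(2f)⟫ = −12π²∫⟪2f, U⟫·… = −12π²` (`integral_inner_laplacian_tgForce`, `integral_norm_sq_tgForce = 1/4`, `v ⊥ f`). [folklore] -/
theorem stub_gaugeForward :
    ∀ (ν : ℝ) (v : UnitAddTorus (Fin 3) → EuclideanSpace ℝ (Fin 3)), IsKField v →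
      (∫ x, inner ℝ (tgForce x) (v x)) = 0 →
      (∀ b, IsKField b → (∫ x, inner ℝ (tgForce x) (b x)) = 0 →
        testedForm ν tgForce ((2 : ℝ) • tgForce + v) b = 0) →
      ∀ a, IsKField a →
        testedForm ν ((2 * ν * (12 * Real.pi ^ 2 + gradNormSq v)) • tgForce) ((2 : ℝ) • tgForce + v) a = 0 :=
  GaugeForward.stub_gaugeForward  -- LANDED (p96779)

/-- **stub_gaugeNorms** (orthogonality bookkeeping of the gauge).  For a `K`-field `v ⊥ f_TG`: `2f_TG + v` is a `K`-field,
`∫|2f_TG + v|² = 1 + ∫|v|²` (`∫|f_TG|² = 1/4`), and `‖∇(2f_TG + v)‖² = 12π² + ‖∇v‖²` (the cross term is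
`−2∫⟪Δ(2f), v⟫ = 48π²∫⟪f,v⟫ = 0`; `‖∇f_TG‖² = −∫⟪f,Δf⟫ = 3π²`). [folklore] -/
theorem stub_gaugeNorms :
    ∀ v : UnitAddTorus (Fin 3) → EuclideanSpace ℝ (Fin 3), IsKField v →
      (∫ x, inner ℝ (tgForce x) (v x)) = 0 →
      IsKField ((2 : ℝ) • tgForce + v) ∧
        (∫ x, ‖((2 : ℝ) • tgForce + v) x‖ ^ 2) = 1 + ∫ x, ‖v x‖ ^ 2 ∧
        gradNormSq ((2 : ℝ) • tgForce + v) = 12 * Real.pi ^ 2 + gradNormSq v :=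
  GaugeNorms.stub_gaugeNorms  -- LANDED (p96359)

/-- **stub_scaling** (exact covariance of the steady problem).  For `s > 0` and smooth `g`, `U`: the tested form, its
linearisation, the enstrophy and the energy transform under `(U, ν, g) ↦ (U/s, ν/s, g/s²)` by the factors `1/s²`, `1/s`,
`1/s²`, `1/s²`, and `U/s` is a `K`-field when `U` is (pointwise linearity of `convect` in the transporting field,
`integral_mul_left`, `partialDeriv_const_smul`). [folklore] -/
theorem stub_scaling :
    ∀ (s ν : ℝ) (g U : UnitAddTorus (Fin 3) → EuclideanSpace ℝ (Fin 3)), 0 < s → IsSmooth g → IsSmooth U →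
      (∀ a, IsSmooth a → testedForm (ν / s) ((1 / s ^ 2) • g) ((1 / s) • U) a = (1 / s ^ 2) * testedForm ν g U a) ∧
      (∀ w a, IsSmooth w → IsSmooth a → linForm (ν / s) ((1 / s) • U) w a = (1 / s) * linForm ν U w a) ∧
      gradNormSq ((1 / s) • U) = (1 / s) ^ 2 * gradNormSq U ∧
      (∫ x, ‖((1 / s) • U) x‖ ^ 2) = (1 / s) ^ 2 * ∫ x, ‖U x‖ ^ 2 ∧
      (IsKField U → IsKField ((1 / s) • U)) :=
  Scaling.stub_scaling  -- LANDED (p96213)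

/-- **stub_gaugeBackward** (the gauge, backward direction; honesty lemma, not used in the composition).  Every `K`-symmetric
steady state `U` of NS(`ν`, `f_TG`) (`ν > 0`, `K`-tested equations) has positive injection `w = ∫⟪f_TG, U⟫` (`= ν‖∇U‖²` by the
energy identity, and `U ≠ const` since `f_TG ≠ 0`), and with `θ := 2w` the field `v := θ⁻¹•U − 2f_TG` is a `K`-field orthogonal
to the force solving the frozen-cell equations at gauge viscosity `ν/θ` (covariance with `s := θ`). [folklore] -/
theorem stub_gaugeBackward :
    ∀ (ν : ℝ) (U : UnitAddTorus (Fin 3) → EuclideanSpace ℝ (Fin 3)), 0 < ν → IsKField U →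
      (∀ a, IsKField a → testedForm ν tgForce U a = 0) →
      0 < ∫ x, inner ℝ (tgForce x) (U x) ∧
      IsKField ((1 / (2 * ∫ x, inner ℝ (tgForce x) (U x))) • U - (2 : ℝ) • tgForce) ∧
      (∫ x, inner ℝ (tgForce x) (((1 / (2 * ∫ x, inner ℝ (tgForce x) (U x))) • U - (2 : ℝ) • tgForce) x)) = 0 ∧
      ∀ b, IsKField b → (∫ x, inner ℝ (tgForce x) (b x)) = 0 →
        testedForm (ν / (2 * ∫ x, inner ℝ (tgForce x) (U x))) tgForce
          ((2 : ℝ) • tgForce + ((1 / (2 * ∫ x, inner ℝ (tgForce x) (U x))) • U - (2 : ℝ) • tgForce)) b = 0 :=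
  GaugeBackward.stub_gaugeBackward  -- LANDED (p96493)

/-! ## §3 The lead's glue (sorry-free): the six stubs above give `stub_froth` with `η_j = 0` -/

/-- A real sequence tending to `0` is bounded above by a positive constant. [folklore] -/
theorem exists_pos_bound_of_tendsto {ν : ℕ → ℝ} (h : Filter.Tendsto ν Filter.atTop (nhds 0)) :
    ∃ B : ℝ, 0 < B ∧ ∀ j, ν j ≤ B := by
  obtain ⟨b, hb⟩ := h.bddAbove_range
  refine ⟨max b 1, lt_max_of_lt_right one_pos, fun j => ?_⟩
  exact (hb ⟨j, rfl⟩).trans (le_max_left _ _)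

/-- **The glue `stub_froth_of_gauge`.**  From the heart and the dictionary: for every Kantorovich threshold `c₀ > 0` the froth
Newton data exist, with `η_j = 0` (exact states), physical viscosities `ν_j/s_j`, states `s_j⁻¹•(2f_TG + v_j)`,
`s_j = √(2ν_j(12π² + ‖∇v_j‖²))`, `E₁ = (1 + C)/(2c)`, `ε₁ = 1/(2√(24π²B + 200(√C + C) + 1))` (`B` a bound of the gauge
viscosities) and inf-sup constants `M_j s_j`. [folklore] -/
theorem stub_froth_of_gauge
    (hheart : ∃ (ν : ℕ → ℝ) (v : ℕ → UnitAddTorus (Fin 3) → EuclideanSpace ℝ (Fin 3)) (C c : ℝ) (M : ℕ → ℝ),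
      (∀ j, 0 < ν j) ∧ Filter.Tendsto ν Filter.atTop (nhds 0) ∧ 0 < c ∧
      ∀ j, IsKField (v j) ∧ (∫ x, inner ℝ (tgForce x) (v j x)) = 0 ∧
        (∀ b, IsKField b → (∫ x, inner ℝ (tgForce x) (b x)) = 0 →
          testedForm (ν j) tgForce ((2 : ℝ) • tgForce + v j) b = 0) ∧
        ∫ x, ‖v j x‖ ^ 2 ≤ C ∧ c ≤ ν j * gradNormSq (v j) ∧
        (∀ w, IsKField w → ∃ a, IsKField a ∧
            Real.sqrt (gradNormSq w) * Real.sqrt (gradNormSq a) ≤ M j * linForm (ν j) ((2 : ℝ) • tgForce + v j) w a ∧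
            (0 < gradNormSq w → 0 < gradNormSq a)))
    (hloudA : ∀ (ν C : ℝ) (v : UnitAddTorus (Fin 3) → EuclideanSpace ℝ (Fin 3)), 0 < ν → 0 ≤ C → IsKField v →
      (∫ x, inner ℝ (tgForce x) (v x)) = 0 →
      (∀ b, IsKField b → (∫ x, inner ℝ (tgForce x) (b x)) = 0 →
        testedForm ν tgForce ((2 : ℝ) • tgForce + v) b = 0) →
      ∫ x, ‖v x‖ ^ 2 ≤ C → ν * gradNormSq v ≤ 100 * (Real.sqrt C + C))
    (hfwd : ∀ (ν : ℝ) (v : UnitAddTorus (Fin 3) → EuclideanSpace ℝ (Fin 3)), IsKField v →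
      (∫ x, inner ℝ (tgForce x) (v x)) = 0 →
      (∀ b, IsKField b → (∫ x, inner ℝ (tgForce x) (b x)) = 0 →
        testedForm ν tgForce ((2 : ℝ) • tgForce + v) b = 0) →
      ∀ a, IsKField a →
        testedForm ν ((2 * ν * (12 * Real.pi ^ 2 + gradNormSq v)) • tgForce) ((2 : ℝ) • tgForce + v) a = 0)
    (hnorms : ∀ v : UnitAddTorus (Fin 3) → EuclideanSpace ℝ (Fin 3), IsKField v →
      (∫ x, inner ℝ (tgForce x) (v x)) = 0 →
      IsKField ((2 : ℝ) • tgForce + v) ∧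
        (∫ x, ‖((2 : ℝ) • tgForce + v) x‖ ^ 2) = 1 + ∫ x, ‖v x‖ ^ 2 ∧
        gradNormSq ((2 : ℝ) • tgForce + v) = 12 * Real.pi ^ 2 + gradNormSq v)
    (hscal : ∀ (s ν : ℝ) (g U : UnitAddTorus (Fin 3) → EuclideanSpace ℝ (Fin 3)), 0 < s → IsSmooth g → IsSmooth U →
      (∀ a, IsSmooth a → testedForm (ν / s) ((1 / s ^ 2) • g) ((1 / s) • U) a = (1 / s ^ 2) * testedForm ν g U a) ∧
      (∀ w a, IsSmooth w → IsSmooth a → linForm (ν / s) ((1 / s) • U) w a = (1 / s) * linForm ν U w a) ∧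
      gradNormSq ((1 / s) • U) = (1 / s) ^ 2 * gradNormSq U ∧
      (∫ x, ‖((1 / s) • U) x‖ ^ 2) = (1 / s) ^ 2 * ∫ x, ‖U x‖ ^ 2 ∧
      (IsKField U → IsKField ((1 / s) • U))) :
    ∀ c₀ : ℝ, 0 < c₀ →
      ∃ (ν : ℕ → ℝ) (v : ℕ → UnitAddTorus (Fin 3) → EuclideanSpace ℝ (Fin 3)) (E₁ ε₁ : ℝ) (η M : ℕ → ℝ),
        (∀ j, 0 < ν j) ∧ Filter.Tendsto ν Filter.atTop (nhds 0) ∧ 0 < ε₁ ∧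
        ∀ j, IsKField (v j) ∧ ∫ x, ‖v j x‖ ^ 2 ≤ E₁ ∧ ε₁ ≤ ν j * gradNormSq (v j) ∧
          (∀ a, IsKField a → |testedForm (ν j) tgForce (v j) a| ≤ η j * Real.sqrt (gradNormSq a)) ∧
          (∀ w, IsKField w → ∃ a, IsKField a ∧
              Real.sqrt (gradNormSq w) * Real.sqrt (gradNormSq a) ≤ M j * linForm (ν j) (v j) w a ∧
              (0 < gradNormSq w → 0 < gradNormSq a)) ∧
          M j ^ 2 * η j ≤ c₀ ∧ (M j * η j) ^ 2 ≤ c₀ * E₁ ∧ ν j * (M j * η j) ^ 2 ≤ c₀ * ε₁ := by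
  intro c₀ hc₀
  obtain ⟨ν, v, C, c, M, hνpos, hνlim, hc, hj⟩ := hheart
  obtain ⟨B, hBpos, hB⟩ := exists_pos_bound_of_tendsto hνlim
  -- names for the per-`j` quantities
  set U : ℕ → UnitAddTorus (Fin 3) → EuclideanSpace ℝ (Fin 3) := fun j => (2 : ℝ) • tgForce + v j with hU
  set β : ℕ → ℝ := fun j => 2 * ν j * (12 * Real.pi ^ 2 + gradNormSq (v j)) with hβ
  set s : ℕ → ℝ := fun j => Real.sqrt (β j) with hs
  set A : ℝ := 100 * (Real.sqrt C + C) with hA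
  set L : ℝ := 24 * Real.pi ^ 2 * B + 2 * A + 1 with hL
  -- facts at each `j`
  have hvK : ∀ j, IsKField (v j) := fun j => (hj j).1
  have hvperp : ∀ j, (∫ x, inner ℝ (tgForce x) (v j x)) = 0 := fun j => (hj j).2.1
  have hcell : ∀ j, ∀ b, IsKField b → (∫ x, inner ℝ (tgForce x) (b x)) = 0 →
      testedForm (ν j) tgForce ((2 : ℝ) • tgForce + v j) b = 0 := fun j => (hj j).2.2.1
  have hvC : ∀ j, ∫ x, ‖v j x‖ ^ 2 ≤ C := fun j => (hj j).2.2.2.1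
  have hvc : ∀ j, c ≤ ν j * gradNormSq (v j) := fun j => (hj j).2.2.2.2.1
  have hinf : ∀ j, ∀ w, IsKField w → ∃ a, IsKField a ∧
      Real.sqrt (gradNormSq w) * Real.sqrt (gradNormSq a) ≤ M j * linForm (ν j) ((2 : ℝ) • tgForce + v j) w a ∧
      (0 < gradNormSq w → 0 < gradNormSq a) := fun j => (hj j).2.2.2.2.2
  have hC0 : 0 ≤ C := le_trans (integral_nonneg fun x => by positivity) (hvC 0)
  have hA0 : 0 ≤ A := by positivity
  have hDA : ∀ j, ν j * gradNormSq (v j) ≤ A := fun j =>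
    hloudA (ν j) C (v j) (hνpos j) hC0 (hvK j) (hvperp j) (hcell j) (hvC j)
  have hgrad0 : ∀ j, 0 ≤ gradNormSq (v j) := fun j => gradNormSq_nonneg _
  -- the amplitude `β j = 24π²ν_j + 2 ν_j‖∇v_j‖²` is pinched between `2c` and `L`
  have hβlow : ∀ j, 2 * c ≤ β j := fun j => by
    have h1 := hvc j
    have h2 : 0 ≤ 2 * ν j * (12 * Real.pi ^ 2) := by have := (hνpos j).le; positivity
    simp only [hβ]
    nlinarith
  have hβpos : ∀ j, 0 < β j := fun j => lt_of_lt_of_le (by linarith) (hβlow j)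
  have hβle : ∀ j, β j ≤ L := fun j => by
    have h1 := hDA j
    have h2 : ν j * (12 * Real.pi ^ 2) ≤ B * (12 * Real.pi ^ 2) :=
      mul_le_mul_of_nonneg_right (hB j) (by positivity)
    simp only [hβ, hL]
    nlinarith
  have hLpos : 0 < L := by positivity
  have hspos : ∀ j, 0 < s j := fun j => Real.sqrt_pos.2 (hβpos j)
  have hssq : ∀ j, s j ^ 2 = β j := fun j => Real.sq_sqrt (hβpos j).le
  have hsL : ∀ j, s j ≤ Real.sqrt L := fun j => Real.sqrt_le_sqrt (hβle j)
  have hsqrtLpos : 0 < Real.sqrt L := Real.sqrt_pos.2 hLpos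
  -- dictionary facts
  have hUK : ∀ j, IsKField (U j) := fun j => (hnorms (v j) (hvK j) (hvperp j)).1
  have hUen : ∀ j, (∫ x, ‖U j x‖ ^ 2) = 1 + ∫ x, ‖v j x‖ ^ 2 := fun j => (hnorms (v j) (hvK j) (hvperp j)).2.1
  have hUgrad : ∀ j, gradNormSq (U j) = 12 * Real.pi ^ 2 + gradNormSq (v j) := fun j =>
    (hnorms (v j) (hvK j) (hvperp j)).2.2
  have hUsm : ∀ j, IsSmooth (U j) := fun j => (hUK j).1
  have hfull : ∀ j, ∀ a, IsKField a → testedForm (ν j) (β j • tgForce) (U j) a = 0 := fun j a ha =>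
    hfwd (ν j) (v j) (hvK j) (hvperp j) (hcell j) a ha
  have hgsm : ∀ j, IsSmooth (β j • tgForce) := fun j => isSmooth_tgForce.smul (β j)
  -- the rescaled (physical) data
  refine ⟨fun j => ν j / s j, fun j => (1 / s j) • U j, (1 + C) / (2 * c), 1 / (2 * Real.sqrt L),
    fun _ => 0, fun j => M j * s j, fun j => div_pos (hνpos j) (hspos j), ?_, by positivity, fun j => ?_⟩
  · -- `ν_j / s_j → 0`: squeezed between `0` and `ν_j / √(2c)`
    have hs2c : ∀ j, Real.sqrt (2 * c) ≤ s j := fun j => Real.sqrt_le_sqrt (hβlow j)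
    have h2c : 0 < Real.sqrt (2 * c) := Real.sqrt_pos.2 (by linarith)
    have hup : Filter.Tendsto (fun j => ν j / Real.sqrt (2 * c)) Filter.atTop (nhds 0) := by
      simpa using hνlim.div_const (Real.sqrt (2 * c))
    refine tendsto_of_tendsto_of_tendsto_of_le_of_le tendsto_const_nhds hup (fun j => ?_) (fun j => ?_)
    · exact (div_pos (hνpos j) (hspos j)).le
    · exact div_le_div_of_nonneg_left (hνpos j).le h2c (hs2c j)
  · obtain ⟨hT, hLin, hG, hE, hKf⟩ := hscal (s j) (ν j) (β j • tgForce) (U j) (hspos j) (hgsm j) (hUsm j)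
    have hforce : (1 / s j ^ 2) • (β j • tgForce) = tgForce := by
      rw [smul_smul, hssq j, one_div, inv_mul_cancel₀ (hβpos j).ne', one_smul]
    refine ⟨hKf (hUK j), ?_, ?_, ?_, ?_, ?_, ?_, ?_⟩
    · -- energy `(1 + ∫|v|²)/β ≤ (1 + C)/(2c)`
      rw [hE, hUen j]
      have h1 : (1 / s j) ^ 2 * (1 + ∫ x, ‖v j x‖ ^ 2) = (1 + ∫ x, ‖v j x‖ ^ 2) / β j := by
        rw [← hssq j]; field_simp
      rw [h1, div_le_div_iff₀ (hβpos j) (by linarith)]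
      have h2 : 0 ≤ ∫ x, ‖v j x‖ ^ 2 := integral_nonneg fun x => by positivity
      nlinarith [hvC j, hβlow j]
    · -- loudness `(ν/s)·(1/s²)·‖∇U‖² = β/(2 s³) = 1/(2s) ≥ 1/(2√L)`
      rw [hG, hUgrad j]
      have h1 : ν j / s j * ((1 / s j) ^ 2 * (12 * Real.pi ^ 2 + gradNormSq (v j))) = 1 / (2 * s j) := by
        have hβj : β j = 2 * ν j * (12 * Real.pi ^ 2 + gradNormSq (v j)) := rfl
        have hsne : s j ≠ 0 := (hspos j).ne'
        field_simp
        nlinarith [hssq j, hβj]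
      rw [h1]
      exact div_le_div_of_nonneg_left zero_le_one (by have := hspos j; positivity)
        (mul_le_mul_of_nonneg_left (hsL j) zero_le_two)
    · -- residual: exact (`η_j = 0`)
      intro a ha
      rw [zero_mul, abs_nonpos_iff, ← hforce, hT a ha.1, hfull j a ha, mul_zero]
    · -- inf-sup with constant `M_j s_j`
      intro w hw
      obtain ⟨a, ha, hle, hnd⟩ := hinf j w hw
      refine ⟨a, ha, ?_, hnd⟩
      rw [hLin w a hw.1 ha.1]
      have hsne : s j ≠ 0 := (hspos j).ne'
      have : M j * s j * (1 / s j * linForm (ν j) (U j) w a) = M j * linForm (ν j) (U j) w a := by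
        rw [one_div, ← mul_assoc, mul_assoc (M j), mul_inv_cancel₀ hsne, mul_one]
      rw [this]
      exact hle
    · simp only [mul_zero]; exact hc₀.le
    · simp only [mul_zero, zero_pow two_ne_zero]
      exact mul_nonneg hc₀.le (div_nonneg (by linarith) (by linarith))
    · simp only [mul_zero, zero_pow two_ne_zero]
      exact mul_nonneg hc₀.le (by positivity)

/-- **stub_froth** (the v3 heart) — now DERIVED from the six registered stubs of §1–§2 by `stub_froth_of_gauge`. -/
theorem stub_froth :
    ∀ c : ℝ, 0 < c →
      ∃ (ν : ℕ → ℝ) (v : ℕ → UnitAddTorus (Fin 3) → EuclideanSpace ℝ (Fin 3)) (E₁ ε₁ : ℝ) (η M : ℕ → ℝ),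
        (∀ j, 0 < ν j) ∧ Filter.Tendsto ν Filter.atTop (nhds 0) ∧ 0 < ε₁ ∧
        ∀ j, IsKField (v j) ∧ ∫ x, ‖v j x‖ ^ 2 ≤ E₁ ∧ ε₁ ≤ ν j * gradNormSq (v j) ∧
          (∀ a, IsKField a → |testedForm (ν j) tgForce (v j) a| ≤ η j * Real.sqrt (gradNormSq a)) ∧
          (∀ w, IsKField w → ∃ a, IsKField a ∧
              Real.sqrt (gradNormSq w) * Real.sqrt (gradNormSq a) ≤ M j * linForm (ν j) (v j) w a ∧
              (0 < gradNormSq w → 0 < gradNormSq a)) ∧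
          M j ^ 2 * η j ≤ c ∧ (M j * η j) ^ 2 ≤ c * E₁ ∧ ν j * (M j * η j) ^ 2 ≤ c * ε₁ :=
  stub_froth_of_gauge stub_gaugeHeart stub_automaticLoudness stub_gaugeForward stub_gaugeNorms stub_scaling

/-! ## §4 The landed registered stubs (tree theorems, restated verbatim; no `sorry`) -/

/-- `stub_tgForceRegular` — LANDED (p75219). -/
theorem stub_tgForceRegular : IsKField tgForce :=
  TgForceRegular.stub_tgForceRegular

/-- `stub_criticality` — LANDED (p77832). -/
theorem stub_criticality : ∀ (ν : ℝ) (N : ℕ) (f U : UnitAddTorus (Fin 3) → EuclideanSpace ℝ (Fin 3)), IsSmooth f → IsKSymm f → IsKField U → IsBandLimited N U → (∀ a, IsSmooth a → IsDivFree a → IsKSymm a → IsBandLimited N a → testedForm ν f U a = 0) → ∀ a, IsSmooth a → IsDivFree a → IsBandLimited N a → testedForm ν f U a = 0 :=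
  Criticality.stub_criticality

/-- `stub_galerkinNewton` — LANDED (glue of `stub_truncation` p85290, `stub_discreteInfSup` p84898, `stub_discreteKantorovich` p87441). -/
theorem stub_galerkinNewton : ∃ c : ℝ, 0 < c ∧ ∀ (ν E₁ ε₁ η M : ℝ) (f v : UnitAddTorus (Fin 3) → EuclideanSpace ℝ (Fin 3)), 0 < ν → IsSmooth f → IsKField v → ∫ x, ‖v x‖ ^ 2 ≤ E₁ → ε₁ ≤ ν * gradNormSq v → (∀ a, IsKField a → |testedForm ν f v a| ≤ η * Real.sqrt (gradNormSq a)) → (∀ w, IsKField w → ∃ a, IsKField a ∧ Real.sqrt (gradNormSq w) * Real.sqrt (gradNormSq a) ≤ M * linForm ν v w a ∧ (0 < gradNormSq w → 0 < gradNormSq a)) → M ^ 2 * η ≤ c → (M * η) ^ 2 ≤ c * E₁ → ν * (M * η) ^ 2 ≤ c * ε₁ → ∀ᶠ N in Filter.atTop, ∃ U : UnitAddTorus (Fin 3) → EuclideanSpace ℝ (Fin 3), IsKField U ∧ IsBandLimited N U ∧ (∀ a, IsSmooth a → IsDivFree a → IsKSymm a → IsBandLimited N a → testedForm ν f U a = 0)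 ∧ ∫ x, ‖U x‖ ^ 2 ≤ 4 * E₁ ∧ ε₁ / 4 ≤ ν * gradNormSq U :=
  GalerkinNewton.stub_galerkinNewton

/-! ## §5 Composition (kernel-checked): the line closes the crux BY NAME modulo the stubs of §1–§2 -/

/-- **The line closes the crux modulo its registered stubs**: `TaylorGreenLoudGalerkinStates_of` (tree) applied to `stub_froth`
(derived from the gauge heart and the dictionary) and the three landed trunk stubs.  Stated WITHOUT hypotheses and concluding the
route decl by name. -/
theorem TaylorGreenLoudGalerkinStates_of_stubs :
    Summit.AnomalousDissipation.AnomalousDissipation.Theses.MirrorVariety.TaylorGreenLoudGalerkinStates :=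
  TaylorGreenLoudGalerkinStates_of stub_froth stub_galerkinNewton stub_criticality stub_tgForceRegular

end Summit.AnomalousDissipation.AnomalousDissipation.Cruxes.TaylorGreenLoudGalerkinStates.StagnationPlugFroth

end
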